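import Summits.ABC.ABC.Theorems.PadicPrimesKummerThirdY07Two
import Summits.ABC.StewartYu.Y07OddExplicit
import HarnessLib

/-!
# Cell abc-stewartyu, route `PadicPrimesKummerThird` (rung A1.M3): the crux `Y07Two` with an EXPLICIT constant,
# and the explicit Yu-2007-quality bound for rational primes at EVERY prime `p`

`Summits/ABC/StewartYu/Y07TwoExplicit.lean` — cell `abc-stewartyu` (HOME `run/shared/lean/pub/abc-stewartyu/`), seat p5 (g5).
Theorems only; a by-product of the closed crux stmt-ABC-19659 (`Summit.ABC.ABC.Theorems.Y07Two_proof`, p3-g6) and the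
twin of `Y07OddExplicit` (odd `p`, `c₆ = 2^103`).

As for odd `p`, the landed `p = 2` chain packages its constant existentially (`TwoSetup.frameTwoLast_all`,
`GenThreeInductionTwo.engineTwo_of_core`, `YuOhSeven.y07Two_of_genThreeEngineTwo`).  This file keeps it in the open:

* `TwoSetup.frameTwoLast_two_pow_110` — the `2`-adic analytic frame for pivot-last data at every rank `d + 1 ≥ 2`
  with `C m = 2^{110 m}` (the body of `TwoSetup.frameTwoLast_all`, p3-g6, verbatim, fed to p5-g3's
  `frameTwoLast_of_numericsRA` instead of the existential wrapper `stub_frameTwoLast_of_numericsRA`);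
* `YuOhSeven.coreTwo_two_pow_110` — the `p = 2` engine's internal statement `CoreTwo C r` at every rank `r` with
  `C m = 2^{110 m}` (Matveev's induction over the landed per-rank dichotomy, zero estimate `Nesterenko2003_prop51_holds`);
* `YuOhSeven.y07Two_explicit` — **for every finite non-empty set `S` of ODD primes, exponents `|e_q| ≤ B` (`B ≥ 3`)
  with `∏ q^{e_q} ≠ 1`:
  `ord₂(∏_{q∈S} q^{e_q} − 1)·log 2 < (2^112)^{#S} · (2/log 2) · (log 2 + log B + log log A) · ∏_{q∈S} log q`,
  `A = max(4, max S)`** (the crux text with `c₆ := 2^112`; the chain gives `3·2^110`, rounded up to a power of two;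
  `αⱼ = qⱼ²`, `ord₂(u − 1) ≤ ord₂(u² − 1)`);
* `YuOhSeven.y07Two_of_explicit` — the crux text `Y07Two` re-derived (second proof);
* `YuOhSeven.y07_explicit` — **ONE constant for ALL primes**: for every prime `p`, every finite non-empty set `S` of
  primes with `p ∉ S`, `|e_q| ≤ B` (`B ≥ 3`), `∏ q^{e_q} ≠ 1`:
  `ord_p(∏_{q∈S} q^{e_q} − 1)·log p < (2^112)^{#S} · (p/log p) · (log p + log B + log log A) · ∏_{q∈S} log q`
  (odd `p`: `y07Odd_explicit`, `2^103 ≤ 2^112`; `p = 2`: `y07Two_explicit`).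

Numbers, for the closing memo of rung A1.M3: the kernel's constant for Yu's 2007 bound over `ℚ` for rational primes is
`2^112` per logarithm at every prime (`2^103` at odd `p`); print: `(16e)^{2(n+1)} n^{5/2} log(2n) log 2` (Yu 2007
p. 190) — the kernel constant is NOT claimed to be of print quality.

References: K. Yu, Forum Math. 19 (2007), Main Theorem (`K = ℚ`, `℘ = 2`); K. Yu, Acta Math. 211 (2013) §§3–6;
Yu. V. Nesterenko, LNM 1819 (2003) §§3–5.
-/

noncomputable section

open Finset
open Literature.NumberTheory.Transcendental
open Literature.NumberTheory.Transcendental.CW77 (heightProd)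
open Literature.NumberTheory.Transcendental.CW77.Setup (Tau tauNorm)
open Literature.NumberTheory.Transcendental.PadicCW77 (condExp)

namespace Summit.ABC.StewartYu

namespace TwoSetup

open Summit.ABC.StewartYu.PadicG3Par Summit.ABC.StewartYu.ParTwo

/-- **The `2`-adic analytic frame for pivot-last data with the explicit constant `C m = 2^{110 m}`**, every rank
`d + 1 ≥ 2`: the body of `frameTwoLast_all` (set-up `ofData`, ledger `parTwo`, the headline `headline_two`, the
smallness of `Λ₀` from the negated bound, the gain lines (L2₀)/(L2)/(L3ᴿ) of the schedule of record `schedTwoS`,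
`datum_package_two`, the record `recordTwo_parTwo`), concluded through `frameTwoLast_of_numericsRA`.
(adapted verbatim from `Summits/ABC/StewartYu/PadicG3TwoClose.lean`, `TwoSetup.frameTwoLast_all`.)
[cite: Yu2007, Main Thm (K = ℚ, ℘ = 2); shape only] -/
theorem frameTwoLast_two_pow_110 (d : ℕ) (hd : 1 ≤ d) :
    GenThreeFramePivotTwo.FrameTwoLast (fun m => (2 : ℝ) ^ (110 * m)) d := by
  refine frameTwoLast_of_numericsRA (C := fun m => (2 : ℝ) ^ (110 * m)) ?_
  intro α b V Vmax W hα hind hKZ hV hV1 hVmax hb hmin hW hW1 hneg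
  -- the set-up and the ledger of the datum
  set S : TwoSetup := ofData d α b hα hb hmin with hSdef
  set P : PadicG3Par (d + 1) := parTwo V Vmax W hV1 hVmax hW1 with hPdef
  -- instantiation facts
  have hp : P.p = 2 := parTwo_p V Vmax W hV1 hVmax hW1
  have hK₀ : P.K₀ = 1 := parTwo_K₀ V Vmax W hV1 hVmax hW1
  have hθ : (1 / 2 : ℝ) ≤ P.θ₀ := parTwo_half_le_θ₀ V Vmax W hV1 hVmax hW1
  have hNq : P.Nq = 2 ^ (P.m + 2) := parTwo_Nq_eq V Vmax W hV1 hVmax hW1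
  have hNqK : P.Nq ≤ 2 ^ (d + 1) * P.K := parTwo_Nq_le V Vmax W hV1 hVmax hW1 hd
  have hAmaxΩ : P.Amax ≤ 2 ^ (d + 1) * P.Ω := parTwo_Amax_le V Vmax W hV1 hVmax hW1
  have hAmaxV : P.Amax ≤ Vmax := parTwo_Amax_le_Vmax V Vmax W hV1 hVmax hW1
  have hA1 : ∀ j, 1 ≤ P.A j := hV1
  have hG : P.G = (P.m + 2) * Real.log 2 := parTwo_G_eq V Vmax W hV1 hVmax hW1
  have hy : 2 * P.G ≤ P.yload := parTwo_yload V Vmax W hV1 hVmax hW1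
  -- datum links for the set-up
  have hαl : ∀ j, Height.logHeight₁ (S.α j) ≤ P.A (Fin.castSucc j) := fun j => hV (Fin.castSucc j)
  have hθl : Height.logHeight₁ S.θ ≤ P.A (Fin.last d) := hV (Fin.last d)
  have hbl : ∀ j, |(S.b j : ℝ)| ≤ Real.exp P.W := fun j => abs_le_exp_of_log_max_le (hW (Fin.castSucc j))
  have hbθl : |(S.bθ : ℝ)| ≤ Real.exp P.W := abs_le_exp_of_log_max_le (hW (Fin.last d))
  have hdepth : 8 * 3 ^ S.Istar3 P ≤ 4 * P.L := S.hdepth_two P hNq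
  -- the smallness from the negated bound through the headline
  set U2 : ℕ := (P.m + 6) * ((d + 3) * (3 ^ (d + 5) * (P.X * P.L))) with hU2
  set Utot : ℕ := (P.m + 6) * ((d + 1 + 2) * (3 ^ (d + 1 + 4) * (P.X * P.L))) + P.m + 3 + ⌈2 * P.W⌉₊ with hUtot
  have hUU : Utot = U2 + P.m + 3 + ⌈2 * P.W⌉₊ := by rw [hUtot, hU2]
  have hhead := P.headline_two hp hK₀ hθ hNqK hAmaxΩ hA1
  have hΩ : P.Ω = ∏ j, V j := parTwo_Ω V Vmax W hV1 hVmax hW1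
  have hVmax1 : 1 ≤ Vmax := (hV1 0).trans (hVmax 0)
  have hlogV : Real.log (2 * P.Amax) ≤ Real.log (2 * Vmax) :=
    Real.log_le_log (by linarith [P.hAmax1]) (by linarith)
  have hprod : 0 ≤ ∏ j, V j := Finset.prod_nonneg fun j _ => by linarith [hV1 j]
  have hWP : P.W = W := rfl
  have hUT : (Utot : ℝ) ≤ (2 : ℝ) ^ (110 * (d + 1)) * (∏ j, V j) * (W + Real.log (2 * Vmax)) := by
    refine hhead.trans ?_
    have h2 : P.Ω * (P.W + Real.log (2 * P.Amax)) ≤ (∏ j, V j) * (W + Real.log (2 * Vmax)) := by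
      rw [hΩ, hWP]
      exact mul_le_mul_of_nonneg_left (by linarith) hprod
    have h3 : (0 : ℝ) ≤ (2 : ℝ) ^ (110 * (d + 1)) := by positivity
    have h4 := mul_le_mul_of_nonneg_left h2 h3
    have e1 : (2 : ℝ) ^ (110 * (d + 1)) * (P.Ω * (P.W + Real.log (2 * P.Amax))) =
        (2 : ℝ) ^ (110 * (d + 1)) * P.Ω * (P.W + Real.log (2 * P.Amax)) := by ring
    have e2 : (2 : ℝ) ^ (110 * (d + 1)) * ((∏ j, V j) * (W + Real.log (2 * Vmax))) =
        (2 : ℝ) ^ (110 * (d + 1)) * (∏ j, V j) * (W + Real.log (2 * Vmax)) := by ring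
    linarith
  have hb0 : b ≠ 0 := fun h0 => hb (by rw [h0]; rfl)
  have hΛ₀ := norm_Λ₀_ofData_le_of_not_le α b hα hb hmin hind hb0 hneg hUT
  -- `‖Λ₀‖ ≤ 2^{−(U2 + m + 3)}`
  have hΛall : ‖S.Λ₀‖ ≤ ((2 : ℝ) ^ (U2 + (P.m + 3)))⁻¹ := by
    have hbW : |(b (Fin.last d) : ℝ)| ≤ (2 : ℝ) ^ ⌈2 * P.W⌉₊ :=
      (abs_le_exp_of_log_max_le (hW (Fin.last d))).trans (exp_le_two_pow_ceil _)
    have h2 : (((2 : ℕ) : ℝ)) ^ (-(Utot : ℤ)) = ((2 : ℝ) ^ Utot)⁻¹ := by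
      rw [zpow_neg, zpow_natCast]; norm_num
    rw [h2] at hΛ₀
    have hsplit : (2 : ℝ) ^ Utot = (2 : ℝ) ^ (U2 + (P.m + 3)) * (2 : ℝ) ^ ⌈2 * P.W⌉₊ := by
      rw [hUU, ← pow_add]; ring_nf
    have hpos1 : (0 : ℝ) < (2 : ℝ) ^ (U2 + (P.m + 3)) := by positivity
    have hpos2 : (0 : ℝ) < (2 : ℝ) ^ ⌈2 * P.W⌉₊ := by positivity
    calc ‖S.Λ₀‖ ≤ |(b (Fin.last d) : ℝ)| * ((2 : ℝ) ^ Utot)⁻¹ := hΛ₀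
      _ ≤ (2 : ℝ) ^ ⌈2 * P.W⌉₊ * ((2 : ℝ) ^ Utot)⁻¹ := mul_le_mul_of_nonneg_right hbW (by positivity)
      _ = ((2 : ℝ) ^ (U2 + (P.m + 3)))⁻¹ := by rw [hsplit, mul_inv, ← mul_assoc, mul_comm, ← mul_assoc,
          inv_mul_cancel₀ hpos2.ne', one_mul]
  have hΛm : ‖S.Λ₀‖ ≤ ((2 : ℝ) ^ (P.m + 3))⁻¹ := le_inv_two_pow_of_le (by omega) hΛall
  have hΛU : ‖S.Λ₀‖ ≤ ((2 : ℝ) ^ U2)⁻¹ := le_inv_two_pow_of_le (by omega) hΛall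
  -- the budget lines: gain branches + first branches
  have hBw0 : ∀ I, 0 ≤ (S.schedTwoS P).Bw I := fun I => by rw [schedTwoS_Bw]; exact (S.Bw3_pos P).le
  have hg₀ := S.hL2zero_gain_schedTwoS P hG hy hA1 hαl hθl hbl hbθl
  have hg := S.hL2_gain_schedTwoS P hG hy hA1 hαl hθl hbl hbθl hdepth
  have hg3 := S.hL3_gain_schedTwoS P hG hy hA1 hαl hθl hbl hbθl hdepth
  refine S.datum_package_two P hNq ?_ ?_ ?_ hΛm
    (recordTwo_parTwo V Vmax W hV1 hVmax hW1 hd (fun r => by positivity) ?_)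
  · -- (L2₀)
    intro k hk x₁ hx₁ τ hτ
    have hB := hg₀ k hk x₁ hx₁ τ hτ
    have hk' : k < d + 3 := by rw [schedTwoS_kst] at hk; exact hk
    have he := S.kExpA_schedTwoS_le P (k := k) hk'
    refine max_lt (lt_of_le_of_lt (first_le_gain (hBw0 0) (le_inv_two_pow_of_le he hΛU)) hB) hB
  · -- (L2)
    intro I hI1 hI k hk x₁ hx₁ τ hτ
    have hB := hg I hI1 hI k hk x₁ hx₁ τ hτ
    have hk' : k < d + 3 := by rw [schedTwoS_kst] at hk; exact hk
    have he := S.kExp_schedTwoS_le P I (k := k) hk'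
    exact kstep_hfinal_of_gain (S.schedTwoS P) (hBw0 I) (le_inv_two_pow_of_le he hΛU) hB
  · -- (L3ᴿ)
    intro I hI s hs h3 τ hτ
    have hB := hg3 I hI s hs h3 τ hτ
    have he := S.tExp_schedTwoS_le P I
    exact third_hfinal_of_gain (S.schedTwoS P) (hBw0 I) (le_inv_two_pow_of_le he hΛU) hB
  · -- admissibility of `C m = 2^{110 m}`: `256^{n−r}·C r ≤ C n`
    intro r hr
    rw [show (256 : ℝ) = 2 ^ 8 by norm_num, ← pow_mul, ← pow_add]
    exact pow_le_pow_right₀ (by norm_num) (by omega)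


end TwoSetup

namespace YuOhSeven

open Summit.ABC.ABC.Theorems

/-- **The `p = 2` engine's internal statement with the explicit constant `C m = 2^{110 m}`**, every rank `r`:
Matveev's induction on the rank over the landed per-rank dichotomy (ranks `0, 1`: `GenThreeBaseTwo`; ranks
`d + 1 ≥ 2`: `TwoSetup.frameTwoLast_two_pow_110` at the zero estimate `Nesterenko2003_prop51_holds`).
[cite: Yu2007, Main Thm (K = ℚ, ℘ = 2); shape only] -/
theorem coreTwo_two_pow_110 (r : ℕ) : GenThreeInductionTwo.CoreTwo (fun m => (2 : ℝ) ^ (110 * m)) r := by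
  refine GenThreeInductionTwo.core_of_dichotomy (fun n => ?_) r
  rcases Nat.lt_or_ge n 2 with hn | hn
  · interval_cases n
    · exact GenThreeBaseTwo.dichotomyTwo_zero _
    · exact GenThreeBaseTwo.dichotomyTwo_one (by norm_num)
  · obtain ⟨d, rfl⟩ : ∃ d, n = d + 1 := ⟨n - 1, by omega⟩
    exact GenThreeFramePivotTwo.dichotomyTwo_of_frameLast Nesterenko2003_prop51_holds (fun r => by positivity)
      (TwoSetup.frameTwoLast_two_pow_110 d (by omega))

/-- **`Y07Two` with the explicit constant `c₆ = 2^112`**: for every finite non-empty set `S` of odd primes,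
exponents `|e_q| ≤ B` (`B ≥ 3`) and `∏ q^{e_q} ≠ 1`,
`ord₂(∏_{q∈S} q^{e_q} − 1)·log 2 < (2^112)^{#S}·(2/log 2)·(log 2 + log B + log log max(4, max S))·∏_{q∈S} log q`
(`αⱼ = qⱼ² ≡ 1 (mod 8)`, independent and `3`-Kummer by unique factorisation; `Vⱼ = 2 log qⱼ`, `Vmax = 2 log A`,
`W = log B` in `coreTwo_two_pow_110`; `ord₂(u − 1) ≤ ord₂(u² − 1)`; the chain's `3·2^110` rounded up to `2^112`).
(transfer adapted from `YuOhSeven.y07Two_of_genThreeEngineTwo`, p1.) [cite: Yu2007, Main Thm (K = ℚ, ℘ = 2); shape only] -/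
theorem y07Two_explicit (S : Finset ℕ) (hS : ∀ q ∈ S, q.Prime) (h2S : 2 ∉ S) (hSne : S.Nonempty)
    (e : ℕ → ℤ) (B : ℝ) (hB : 3 ≤ B) (heB : ∀ q ∈ S, (|e q| : ℝ) ≤ B) (hne1 : ∏ q ∈ S, (q : ℚ) ^ e q ≠ 1) :
    (padicValRat 2 (∏ q ∈ S, (q : ℚ) ^ e q - 1) : ℝ) * Real.log 2 <
      ((2 : ℝ) ^ 112) ^ S.card * ((2 : ℝ) / Real.log 2) *
        (Real.log 2 + Real.log B + Real.log (Real.log ((max 4 (S.sup id) : ℕ) : ℝ))) *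
        ∏ q ∈ S, Real.log (q : ℝ) := by
  classical
  -- enumeration of `S`
  set m : ℕ := S.card with hm
  have hm1 : 1 ≤ m := Finset.card_pos.mpr hSne
  set φ : Fin m ≃ S := S.equivFin.symm with hφ
  set q : Fin m → ℕ := fun i => (φ i : ℕ) with hqdef
  have hqS : ∀ i, q i ∈ S := fun i => (φ i).2
  have hqP : ∀ i, (q i).Prime := fun i => hS _ (hqS i)
  have hinj : Function.Injective q := fun i j hij => φ.injective (Subtype.ext hij)
  have hq2 : ∀ i, q i ≠ 2 := fun i h => h2S (h ▸ hqS i)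
  have hq3 : ∀ i, 3 ≤ q i := fun i => by have h2 := (hqP i).two_le; have := hq2 i; omega
  have hreidx : ∀ {M : Type} [CommMonoid M] (f : ℕ → M), ∏ i, f (q i) = ∏ x ∈ S, f x := by
    intro M _ f
    rw [← Finset.prod_coe_sort S f]
    exact Fintype.prod_equiv φ (fun i => f (q i)) (fun x => f x) (fun i => rfl)
  -- the data fed to the engine
  set M4 : ℝ := ((max 4 (S.sup id) : ℕ) : ℝ) with hM4
  set X : ℝ := Real.log M4 with hX
  set α : Fin m → ℚ := fun j => (q j : ℚ) ^ 2 with hα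
  set b : Fin m → ℤ := fun j => e (q j) with hb
  set V : Fin m → ℝ := fun j => 2 * Real.log (q j : ℝ) with hV
  set Vmax : ℝ := 2 * X with hVmax
  set W : ℝ := Real.log B with hW
  have hX1 : (1.38 : ℝ) ≤ X := log_max_four_ge (S.sup id)
  have hℓ : (0.27 : ℝ) ≤ Real.log X := PadicPrimesYuNinetyRung.loglog_max_four_ge (S.sup id)
  have hX0 : 0 < X := by linarith
  have hlog3 : (1 : ℝ) < Real.log 3 := by
    rw [Real.lt_log_iff_exp_lt (by norm_num)]
    exact Real.exp_one_lt_d9.trans (by norm_num)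
  have hlogq : ∀ j, (1 : ℝ) < Real.log (q j : ℝ) := fun j =>
    hlog3.trans_le (Real.log_le_log (by norm_num) (by exact_mod_cast hq3 j))
  -- `W ≥ 1` (`B ≥ 3 > e`)
  have hW1 : 1 ≤ W := hlog3.le.trans (Real.log_le_log (by norm_num) hB)
  -- the engine's hypotheses
  have h1 : ∀ j, 3 ≤ padicValRat 2 (α j - 1) := fun j =>
    three_le_padicValRat_sq_sub_one (hqP j) (hq2 j)
  have hα0 : ∀ j, α j ≠ 0 := fun j => TwoSetup.ne_zero_of_three_le (h1 j)
  have h2 : ∀ μ : Fin m → ℤ, ∏ j, α j ^ μ j = 1 → μ = 0 := by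
    intro μ hμ
    have hμ' : ∏ j, (q j : ℚ) ^ ((2 : ℤ) * μ j) = 1 := by
      rw [← hμ]
      refine Finset.prod_congr rfl fun j _ => ?_
      simp only [hα]
      rw [zpow_mul]; norm_cast
    have h0 := Literature.Barriers.ABC.StewartTijdemanGeneric.prime_family_zpow_eq_one hqP hinj hμ'
    funext j
    have := congrFun h0 j
    simp only [Pi.zero_apply, mul_eq_zero, OfNat.ofNat_ne_zero, false_or] at this
    exact this
  have h3 : ∀ κ : Fin m → ℕ, (∃ j, ¬ 3 ∣ κ j) → ∀ γ : ℚ, ∏ j, α j ^ κ j ≠ γ ^ 3 :=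
    fun κ hκ γ => (not_cube_prod_sq_primes q hqP hinj κ hκ γ).symm
  have h3Z : ∀ κ : Fin m → ℤ, (∃ γ : ℚ, ∏ j, α j ^ κ j = γ ^ 3) → ∀ j, (3 : ℤ) ∣ κ j := by
    have h := KummerBasisChange.kummerInt_of_kummerNat 3 (by norm_num) α hα0 h3
    exact fun κ hκ j => by exact_mod_cast h κ hκ j
  have h4 : ∀ j, Height.logHeight₁ (α j) ≤ V j := by
    intro j
    haveI : NeZero (q j ^ 2) := ⟨pow_ne_zero _ (hqP j).ne_zero⟩
    have hh : Height.logHeight₁ (α j) = 2 * Real.log (q j) := by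
      have : α j = ((q j ^ 2 : ℕ) : ℚ) := by simp only [hα]; push_cast; ring
      rw [this, Rat.logHeight₁_natCast (q j ^ 2)]
      push_cast
      rw [Real.log_pow]; norm_num
    rw [hh]
  have h5 : ∀ j, 1 ≤ V j := fun j => by show (1 : ℝ) ≤ 2 * Real.log (q j : ℝ); linarith [hlogq j]
  have h6 : ∀ j, V j ≤ Vmax := by
    intro j
    have hle : (q j : ℝ) ≤ M4 := by
      rw [hM4]
      exact_mod_cast (le_max_right 4 (q j)).trans (max_le_max le_rfl (Finset.le_sup (f := id) (hqS j)))
    have hpos : (0 : ℝ) < (q j : ℝ) := by exact_mod_cast (hqP j).pos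
    show 2 * Real.log (q j : ℝ) ≤ 2 * X
    linarith [Real.log_le_log hpos hle]
  -- `∏ αⱼ^{bⱼ} = u²`, `u = ∏_{q ∈ S} q^{e_q}`
  set u : ℚ := ∏ x ∈ S, (x : ℚ) ^ e x with hu
  have hprodQ : ∏ j, (q j : ℚ) ^ b j = u := hreidx (fun x => (x : ℚ) ^ e x)
  have hprodα : ∏ j, α j ^ b j = u ^ 2 := by
    rw [← hprodQ, ← Finset.prod_pow]
    refine Finset.prod_congr rfl fun j _ => ?_
    simp only [hα]
    rw [← zpow_natCast, ← zpow_natCast, ← zpow_mul, ← zpow_mul, mul_comm]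
  have h7 : b ≠ 0 := by
    intro h0
    apply hne1
    rw [← hprodQ]
    exact Finset.prod_eq_one fun j _ => by rw [show b j = 0 from congrFun h0 j, zpow_zero]
  have hB0 : 0 < Real.log B := Real.log_pos (by linarith)
  have h8 : ∀ j, Real.log (max 3 (|b j| : ℝ)) ≤ W := by
    intro j
    have hle : max 3 (|b j| : ℝ) ≤ B := max_le hB (by simp only [hb]; exact heB _ (hqS j))
    exact Real.log_le_log (lt_of_lt_of_le (by norm_num) (le_max_left _ _)) hle
  -- the engine
  have key := coreTwo_two_pow_110 m α b V Vmax W h1 h2 h3Z h4 h5 h6 h7 h8 hW1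
  rw [hprodα] at key
  -- `ord₂(u − 1) ≤ ord₂(u² − 1)`
  have hu1 : u - 1 ≠ 0 := sub_ne_zero.mpr hne1
  have hupos : 0 < u := Finset.prod_pos fun x hx => zpow_pos (by exact_mod_cast (hS x hx).pos) _
  have hu1' : u + 1 ≠ 0 := by linarith
  have hvu : padicValRat 2 u = 0 := by
    rw [hu, Summit.ABC.StewartYu.PrincipalLattice.padicValRat_finset_prod _ _
      fun x hx => zpow_ne_zero _ (by exact_mod_cast (hS x hx).ne_zero)]
    refine Finset.sum_eq_zero fun x hx => ?_
    rw [padicValRat.zpow,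
      Literature.Barriers.ABC.StewartTijdemanGeneric.padicValRat_natCast_prime_of_ne Nat.prime_two
        (hS x hx) (fun h => h2S (h ▸ hx))]
    simp
  have hvplus : 0 ≤ padicValRat 2 (u + 1) := by
    have h := padicValRat.min_le_padicValRat_add (p := 2) hu1'
    rwa [hvu, padicValRat.one, min_self] at h
  have hvsq : padicValRat 2 (u ^ 2 - 1) = padicValRat 2 (u - 1) + padicValRat 2 (u + 1) := by
    rw [show u ^ 2 - 1 = (u - 1) * (u + 1) by ring, padicValRat.mul hu1 hu1']
  have hvle : (padicValRat 2 (u - 1) : ℝ) ≤ (padicValRat 2 (u ^ 2 - 1) : ℝ) := by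
    rw [hvsq]; push_cast
    linarith [(show (0 : ℝ) ≤ (padicValRat 2 (u + 1) : ℝ) by exact_mod_cast hvplus)]
  -- `∏ Vⱼ = 2^m · PL`
  set PL : ℝ := ∏ x ∈ S, Real.log (x : ℝ) with hPL
  have hPV : ∏ j, V j = 2 ^ m * PL := by
    rw [hPL, ← hreidx (fun x => Real.log (x : ℝ))]
    simp only [hV]
    rw [Finset.prod_mul_distrib, Finset.prod_const, Finset.card_univ, Fintype.card_fin]
  have hPL0 : 0 < PL := by
    rw [hPL, ← hreidx (fun x => Real.log (x : ℝ))]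
    exact Finset.prod_pos fun j _ => by linarith [hlogq j]
  have hlX0 : 0 < Real.log X := by linarith
  -- the garbage: `W + log 2Vmax = log B + log 4 + log X ≤ 2·(log 2 + log B + log X)`
  set G : ℝ := Real.log 2 + Real.log B + Real.log X with hG
  have hl2 := Real.log_two_gt_d9
  have hG0 : 0 < G := by rw [hG]; linarith
  have hl2V : Real.log (2 * Vmax) = 2 * Real.log 2 + Real.log X := by
    rw [hVmax, show (2 : ℝ) * (2 * X) = 2 ^ 2 * X by ring, Real.log_mul (by norm_num) hX0.ne',
      Real.log_pow]; norm_num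
  have hgarb : W + Real.log (2 * Vmax) ≤ 2 * G := by rw [hl2V, hG, hW]; linarith
  -- assemble
  set v : ℝ := (padicValRat 2 (u - 1) : ℝ) with hv
  set Cm : ℝ := (2 : ℝ) ^ (110 * m) with hCm
  have hCm0 : 0 ≤ Cm := by positivity
  have hstep1 : v * Real.log 2 ≤ Cm * (2 ^ m * PL) * (2 * G) * Real.log 2 := by
    have h0 : 0 ≤ Cm * (2 ^ m * PL) := mul_nonneg hCm0 (mul_nonneg (pow_nonneg (by norm_num) m) hPL0.le)
    have hk : v ≤ Cm * (2 ^ m * PL) * (2 * G) :=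
      calc v ≤ (padicValRat 2 (u ^ 2 - 1) : ℝ) := hvle
        _ ≤ Cm * (∏ j, V j) * (W + Real.log (2 * Vmax)) := key
        _ = Cm * (2 ^ m * PL) * (W + Real.log (2 * Vmax)) := by rw [hPV]
        _ ≤ Cm * (2 ^ m * PL) * (2 * G) := mul_le_mul_of_nonneg_left hgarb h0
    exact mul_le_mul_of_nonneg_right hk (by linarith)
  have hstep2 : Cm * (2 ^ m * PL) * (2 * G) * Real.log 2 = (Cm * 2 ^ m) * (2 * Real.log 2) * (G * PL) := by ring
  -- `Cm · 2^m · 2 log 2 < Cm · 3^m · (2/log 2) ≤ (2^112)^m · (2/log 2)`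
  have hc0 : 0 < Cm * (2 : ℝ) ^ m := by positivity
  have h23 : Cm * (2 : ℝ) ^ m ≤ Cm * 3 ^ m :=
    mul_le_mul_of_nonneg_left (pow_le_pow_left₀ (by norm_num) (by norm_num) m) hCm0
  have h112 : Cm * (3 : ℝ) ^ m ≤ ((2 : ℝ) ^ 112) ^ m := by
    have e1 : Cm * (3 : ℝ) ^ m = ((2 : ℝ) ^ 110 * 3) ^ m := by rw [hCm, mul_pow, pow_mul]
    rw [e1]
    exact pow_le_pow_left₀ (by positivity) (by norm_num) m
  have hGP : 0 < G * PL := mul_pos hG0 hPL0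
  have hdiv0 : (0 : ℝ) ≤ 2 / Real.log 2 := div_nonneg (by norm_num) (by linarith)
  calc v * Real.log 2 ≤ Cm * (2 ^ m * PL) * (2 * G) * Real.log 2 := hstep1
    _ = (Cm * 2 ^ m) * (2 * Real.log 2) * (G * PL) := hstep2
    _ < ((2 : ℝ) ^ 112) ^ m * (2 / Real.log 2) * (G * PL) := by
        have hA : (Cm * 2 ^ m) * (2 * Real.log 2) < ((2 : ℝ) ^ 112) ^ m * (2 / Real.log 2) :=
          calc (Cm * 2 ^ m) * (2 * Real.log 2) < (Cm * 2 ^ m) * (2 / Real.log 2) :=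
                mul_lt_mul_of_pos_left two_mul_log_two_lt_two_div hc0
            _ ≤ ((2 : ℝ) ^ 112) ^ m * (2 / Real.log 2) := mul_le_mul_of_nonneg_right (h23.trans h112) hdiv0
        exact mul_lt_mul_of_pos_right hA hGP
    _ = ((2 : ℝ) ^ 112) ^ m * (2 / Real.log 2) * G * PL := by ring

/-- The crux text `Y07Two` re-derived from the explicit form (`c₆ := 2^112`): a second, constant-bearing proof of
the closed crux stmt-ABC-19659. [cite: Yu2007, Main Thm (K = ℚ, ℘ = 2)] -/
theorem y07Two_of_explicit : Summit.ABC.ABC.Theses.PadicPrimesKummerThird.Y07Two :=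
  ⟨(2 : ℝ) ^ 112, fun S hS h2S hSne e B hB heB hne1 => y07Two_explicit S hS h2S hSne e B hB heB hne1⟩

/-- **Yu's 2007 bound over `ℚ` for rational primes, ONE explicit constant at EVERY prime**: for every prime `p`,
every finite non-empty set `S` of primes with `p ∉ S`, exponents `|e_q| ≤ B` (`B ≥ 3`) with `∏ q^{e_q} ≠ 1`,
`ord_p(∏_{q∈S} q^{e_q} − 1)·log p < (2^112)^{#S}·(p/log p)·(log p + log B + log log max(4, max S))·∏_{q∈S} log q`
(odd `p`: `y07Odd_explicit` with `2^103 ≤ 2^112`; `p = 2`: `y07Two_explicit`). [cite: Yu2007, Main Thm (K = ℚ); shape only] -/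
theorem y07_explicit (p : ℕ) (hp : p.Prime) (S : Finset ℕ) (hS : ∀ q ∈ S, q.Prime) (hpS : p ∉ S)
    (hSne : S.Nonempty) (e : ℕ → ℤ) (B : ℝ) (hB : 3 ≤ B) (heB : ∀ q ∈ S, (|e q| : ℝ) ≤ B)
    (hne1 : ∏ q ∈ S, (q : ℚ) ^ e q ≠ 1) :
    (padicValRat p (∏ q ∈ S, (q : ℚ) ^ e q - 1) : ℝ) * Real.log p <
      ((2 : ℝ) ^ 112) ^ S.card * ((p : ℝ) / Real.log p) *
        (Real.log p + Real.log B + Real.log (Real.log ((max 4 (S.sup id) : ℕ) : ℝ))) *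
        ∏ q ∈ S, Real.log (q : ℝ) := by
  by_cases hp2 : p = 2
  · subst hp2
    have h := y07Two_explicit S hS hpS hSne e B hB heB hne1
    push_cast at h ⊢
    exact h
  · have h := y07Odd_explicit p hp hp2 S hS hpS hSne e B hB heB hne1
    refine h.trans_le ?_
    -- monotonicity in the constant: the other three factors are non-negative
    have hX1 : (1.38 : ℝ) ≤ Real.log ((max 4 (S.sup id) : ℕ) : ℝ) := log_max_four_ge (S.sup id)
    have hℓ : (0.27 : ℝ) ≤ Real.log (Real.log ((max 4 (S.sup id) : ℕ) : ℝ)) :=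
      PadicPrimesYuNinetyRung.loglog_max_four_ge (S.sup id)
    have hlogp : 0 ≤ Real.log p := Real.log_natCast_nonneg p
    have hlogB : 0 ≤ Real.log B := Real.log_nonneg (by linarith)
    have hpl : 0 ≤ (p : ℝ) / Real.log p := div_nonneg (Nat.cast_nonneg p) hlogp
    have hPL : 0 ≤ ∏ q ∈ S, Real.log (q : ℝ) :=
      Finset.prod_nonneg fun q hq => Real.log_nonneg (by exact_mod_cast (hS q hq).one_lt.le)
    have hfac : 0 ≤ ((p : ℝ) / Real.log p) *
        (Real.log p + Real.log B + Real.log (Real.log ((max 4 (S.sup id) : ℕ) : ℝ))) *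
        ∏ q ∈ S, Real.log (q : ℝ) := mul_nonneg (mul_nonneg hpl (by linarith)) hPL
    have hpow : ((2 : ℝ) ^ 103) ^ S.card ≤ ((2 : ℝ) ^ 112) ^ S.card :=
      pow_le_pow_left₀ (by positivity) (by norm_num) _
    have := mul_le_mul_of_nonneg_right hpow hfac
    linarith [this]

end YuOhSeven

end Summit.ABC.StewartYu

end
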